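import Summits.QuantumFields.YangMills.Theorems.BalabanUVNodesN07SplitClauseHeadBudgetAffineMeet
import HarnessLib

/-!
# N07 [B11] (= [15] = [Balaban1985Variational]) Sect. F, road of record R0′, S6 HEAD — **THE OUTWARD MEET EDITION, FILE J: THE BUDGET FOR AFFINE LETTERS ON THE NORMALISED ROAD (n07-e g23 MODULE 59 `…HeadKnitMeetNormalised`, `HBUDGET-NORM`: no `t_∂`, strict sum)**
# strict sum) — FILE E `…BudgetAffineMeet` re-run WITHOUT the shear row: explicit `C θ Q` from affine letters with non-negative coefficients, one call per `(ε, δ, j)`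

Cell `pub-ymgap`, width seat `pub-ymgap-dag-n07-w4` g5 (sub-target S6 = the HEAD; MODULE 57 default pen), INTENT-10 (cell bus; n07-e g23's offer I.≈41650 «yours if you want it»).  `--kind proof --supports stmt-QuantumFields-27364 --as helper`
(K1⁹ per dag-lead KEY MAP v2); count-neutral; def-free; elementary real arithmetic only.

WHAT IS PROVED (sorry-free; no definition; axioms standard).  ★★ `budget_affine_meet_norm` — with `M′ > 0`, `C_H B_H θ_H ≥ 0`, letters `β₁ β₂ t₁` affine in `(δ, ε, ε²)` with
non-negative coefficients (`s′` affine, any signs), `0 < δ`, `0 ≤ ε`: `∃ t₂ t₃` above the floors `¼M′·max{4C_HB_Hβ₁, θ_Hβ₂}`, `2C_HB_Hs′` with the STRICT `t₁ + t₂ + t₃ < Cδ + θε + Qε²`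
for the EXPLICIT `C = M′C_HB_Hb₁₁ + ¼M′θ_Hb₂₁ + 2C_HB_Hs₁ + q₁ + 1`, `θ, Q` likewise (indices 2, 3, no `+1`); ★ `budget_affine_fun_meet_norm` — the letter-function form (MODULE 59's
`HBUDGET-NORM` antecedent shape at one `(ε, δ, j)`).  NOTE: `θ` is the SUM of the letters' ε-coefficients; `16θ ≤ 1` is a separate hypothesis of the knit, NOT claimed here.
HONEST SCOPE.  Arithmetic; no N07 content; nothing of [15] asserted; `HBUDGET` of FILE D is DISCHARGED by this only for letters of the stated shape supplied by the chart lane; no token ∕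
stub ∕ K-item closed; N07 NOT discharged; counts unmoved (typed 28∕28 · discharged 5∕27); one finite 𝕋⁴ programme at fixed ε — the route closes the conditional finite-𝕋⁴ rung
`BalabanLadder.UV` ONLY; the YM mass gap (Clay) is NOT proved by any of this.  No `sorry` ∕ `def` ∕ `instance` ∕ `notation`.

References: [15] (160)–(161) p. 303, (162)–(166) pp. 303–304, (165) p. 304.
-/

set_option autoImplicit false

noncomputable section

namespace Summit.QuantumFields.YangMills.BalabanUVNodes.N07SplitClauseHeadBudgetAffineMeetNorm

/-- ★★ **THE BUDGET FOR AFFINE LETTERS, ONE LEVEL, NORMALISED-ROAD CURRENCIES (no shear row)**: thresholds `t₂ t₃` above the floors `¼M′·max{4C_HB_Hβ₁, θ_Hβ₂}`, `2C_HB_Hs′`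
with the STRICT `t₁ + t₂ + t₃ < Cδ + θε + Qε²` for the explicit `C = M′C_HB_Hb₁₁ + ¼M′θ_Hb₂₁ + 2C_HB_Hs₁ + q₁ + 1`, `θ, Q` likewise (indices 2, 3, no `+1`).
[cite: Balaban1985Variational, (165) p.304, (162)–(166) pp.303–304 (bookkeeping)] -/
theorem budget_affine_meet_norm {M' CH BH θH : ℝ} (hM' : 0 < M') (hCH : 0 ≤ CH) (hBH : 0 ≤ BH) (hθH : 0 ≤ θH)
    {b₁₁ b₁₂ b₁₃ b₂₁ b₂₂ b₂₃ s₁ s₂ s₃ q₁ q₂ q₃ : ℝ}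
    (hb₁₁ : 0 ≤ b₁₁) (hb₁₂ : 0 ≤ b₁₂) (hb₁₃ : 0 ≤ b₁₃) (hb₂₁ : 0 ≤ b₂₁) (hb₂₂ : 0 ≤ b₂₂) (hb₂₃ : 0 ≤ b₂₃)
    {δ ε : ℝ} (hδ : 0 < δ) (hε : 0 ≤ ε) :
    ∃ t₂ t₃ : ℝ,
      1 / 4 * M' * max (4 * CH * BH * (b₁₁ * δ + b₁₂ * ε + b₁₃ * ε ^ 2)) (θH * (b₂₁ * δ + b₂₂ * ε + b₂₃ * ε ^ 2)) < t₂ ∧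
      2 * CH * BH * (s₁ * δ + s₂ * ε + s₃ * ε ^ 2) < t₃ ∧
      (q₁ * δ + q₂ * ε + q₃ * ε ^ 2) + t₂ + t₃ <
        (M' * CH * BH * b₁₁ + 1 / 4 * M' * θH * b₂₁ + 2 * CH * BH * s₁ + q₁ + 1) * δ +
        (M' * CH * BH * b₁₂ + 1 / 4 * M' * θH * b₂₂ + 2 * CH * BH * s₂ + q₂) * ε +
        (M' * CH * BH * b₁₃ + 1 / 4 * M' * θH * b₂₃ + 2 * CH * BH * s₃ + q₃) * ε ^ 2 := by
  have hε2 : 0 ≤ ε ^ 2 := sq_nonneg ε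
  set B1 := b₁₁ * δ + b₁₂ * ε + b₁₃ * ε ^ 2 with hB1
  set B2 := b₂₁ * δ + b₂₂ * ε + b₂₃ * ε ^ 2 with hB2
  set S := s₁ * δ + s₂ * ε + s₃ * ε ^ 2 with hS
  have hB1n : 0 ≤ B1 := by rw [hB1]; positivity
  have hB2n : 0 ≤ B2 := by rw [hB2]; positivity
  have hCB : 0 ≤ CH * BH := mul_nonneg hCH hBH
  -- the `max` by a sum
  have hX₂ : 1 / 4 * M' * max (4 * CH * BH * B1) (θH * B2) ≤ M' * CH * BH * B1 + 1 / 4 * M' * θH * B2 := by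
    have hm := max_le_add_of_nonneg (by positivity : 0 ≤ 4 * CH * BH * B1) (by positivity : 0 ≤ θH * B2)
    have hM0 : 0 ≤ 1 / 4 * M' := by positivity
    calc 1 / 4 * M' * max (4 * CH * BH * B1) (θH * B2)
        ≤ 1 / 4 * M' * (4 * CH * BH * B1 + θH * B2) := mul_le_mul_of_nonneg_left hm hM0
      _ = M' * CH * BH * B1 + 1 / 4 * M' * θH * B2 := by ring
  refine ⟨1 / 4 * M' * max (4 * CH * BH * B1) (θH * B2) + δ / 3, 2 * CH * BH * S + δ / 3, by linarith, by linarith, ?_⟩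
  have hexp : (M' * CH * BH * b₁₁ + 1 / 4 * M' * θH * b₂₁ + 2 * CH * BH * s₁ + q₁ + 1) * δ +
        (M' * CH * BH * b₁₂ + 1 / 4 * M' * θH * b₂₂ + 2 * CH * BH * s₂ + q₂) * ε +
        (M' * CH * BH * b₁₃ + 1 / 4 * M' * θH * b₂₃ + 2 * CH * BH * s₃ + q₃) * ε ^ 2 =
      (q₁ * δ + q₂ * ε + q₃ * ε ^ 2) + (M' * CH * BH * B1 + 1 / 4 * M' * θH * B2) + 2 * CH * BH * S + δ := by
    rw [hB1, hB2, hS]; ring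
  rw [hexp]
  linarith

/-- ★ **THE SAME FOR LETTER FUNCTIONS OF `(ε, δ, j)`** — the literal shape of MODULE 59's `HBUDGET-NORM` antecedent at one `(ε, δ, j)` (`M′ := sideP …` cast): affine letters AT
`(ε, δ, j)` with the given non-negative coefficients ⇒ the thresholds with `budget_affine_meet`'s explicit `C θ Q` (`0 < δ j`; `0 ≤ ε j` from `B₃·δ j ≤ ε j`, `0 < B₃`).
[cite: Balaban1985Variational, (165) p.304, (162)–(166) pp.303–304 (bookkeeping)] -/
theorem budget_affine_fun_meet_norm {M' CH BH θH : ℝ} (hM' : 0 < M') (hCH : 0 ≤ CH) (hBH : 0 ≤ BH) (hθH : 0 ≤ θH)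
    {b₁₁ b₁₂ b₁₃ b₂₁ b₂₂ b₂₃ s₁ s₂ s₃ q₁ q₂ q₃ : ℝ}
    (hb₁₁ : 0 ≤ b₁₁) (hb₁₂ : 0 ≤ b₁₂) (hb₁₃ : 0 ≤ b₁₃) (hb₂₁ : 0 ≤ b₂₁) (hb₂₂ : 0 ≤ b₂₂) (hb₂₃ : 0 ≤ b₂₃)
    (β₁ β₂ s' t₁ : (ℕ → ℝ) → (ℕ → ℝ) → ℕ → ℝ) (ε δ : ℕ → ℝ) (j : ℕ)
    (hβ₁ : β₁ ε δ j = b₁₁ * δ j + b₁₂ * ε j + b₁₃ * ε j ^ 2) (hβ₂ : β₂ ε δ j = b₂₁ * δ j + b₂₂ * ε j + b₂₃ * ε j ^ 2)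
    (hs' : s' ε δ j = s₁ * δ j + s₂ * ε j + s₃ * ε j ^ 2)
    (ht₁ : t₁ ε δ j = q₁ * δ j + q₂ * ε j + q₃ * ε j ^ 2)
    {B₃ : ℝ} (hB₃ : 0 < B₃) (hδ : 0 < δ j) (hεδ : B₃ * δ j ≤ ε j) :
    ∃ t₂ t₃ : ℝ,
      1 / 4 * M' * max (4 * CH * BH * β₁ ε δ j) (θH * β₂ ε δ j) < t₂ ∧
      2 * CH * BH * s' ε δ j < t₃ ∧
      t₁ ε δ j + t₂ + t₃ <
        (M' * CH * BH * b₁₁ + 1 / 4 * M' * θH * b₂₁ + 2 * CH * BH * s₁ + q₁ + 1) * δ j +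
        (M' * CH * BH * b₁₂ + 1 / 4 * M' * θH * b₂₂ + 2 * CH * BH * s₂ + q₂) * ε j +
        (M' * CH * BH * b₁₃ + 1 / 4 * M' * θH * b₂₃ + 2 * CH * BH * s₃ + q₃) * ε j ^ 2 := by
  have hε : 0 ≤ ε j := le_trans (mul_pos hB₃ hδ).le hεδ
  rw [hβ₁, hβ₂, hs', ht₁]
  exact budget_affine_meet_norm hM' hCH hBH hθH hb₁₁ hb₁₂ hb₁₃ hb₂₁ hb₂₂ hb₂₃ hδ hε

end Summit.QuantumFields.YangMills.BalabanUVNodes.N07SplitClauseHeadBudgetAffineMeetNorm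

end
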